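import Mathlib.LinearAlgebra.Eigenspace.Charpoly
import Mathlib.FieldTheory.IsAlgClosed.Basic
import Mathlib.Analysis.Complex.Polynomial.Basic
import Literature.NumberTheory.GaloisRepresentations.ArtinLFunction
import Literature.NumberTheory.GaloisRepresentations.IntegralGaloisActionProofs
import HarnessLib

/-!
# Euler factors of Artin representations with finite image (proofs)

Two elementary facts about the Euler factors
`L_v(ρ, T) = det(1 - T ρ(Frob_𝔓) | V^{I_𝔓})` (`Literature.NumberTheory.GaloisRepresentations.ArtinRep.eulerFactorAt`,
`Literature.NumberTheory.GaloisRepresentations.ArtinLFunction`) of an Artin representation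
`ρ : Γ_K → GL(V)` with **finite image**, used in step (iii)–(iv) of the proof of Deligne–Serre,
*Formes modulaires de poids 1*, Ann. Sci. ÉNS (4) 7 (1974), Thm. 4.6 (pp. 515–516; decomposition
of the named fact `Literature.NumberTheory.Automorphic.artinConductorNat_eq_level`, top layer
`Literature.NumberTheory.Automorphic.LanglandsTunnellProofs`):

* `Literature.NumberTheory.GaloisRepresentations.ArtinRep.exists_card_le_eval_eulerFactorAt_eq_prod` (and the shorter
  `exists_eval_eulerFactorAt_eq_prod`) — at *every* finite place,
  `L_v(ρ, z) = ∏_i (1 - β_i z)` for a multiset of at most `dim V` complex numbers `β_i` of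
  absolute value `1`
  (the eigenvalues of a Frobenius on the inertia invariants are roots of unity, the operator
  having finite order); this is "`b_p` et `c_p` sont, soit `0`, soit des racines de l'unité"
  (op. cit. p. 516, (iv)), the vanishing ones being absent from the multiset.  The junk branch of
  `eulerFactorAt` (no Frobenius pair; it does not occur over number fields) is the empty product.
* `Literature.NumberTheory.GaloisRepresentations.ArtinRep.eulerFactorAt_eq_reverse_of_isUnramifiedAt` — at an unramified place where all
  arithmetic Frobenii have characteristic polynomial `P` (`GaloisRep.HasFrobCharpolyAt v P ρ`),
  `L_v(ρ, T) = P^rev(T)`; e.g. `P = X² - a_p X + ε(p)` gives `1 - a_p T + ε(p) T²`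
  ((4.1.1); `Literature.NumberTheory.GaloisRepresentations.eval_reverse_X_sq_sub_add`).  A Frobenius pair exists by the *proved*
  `HeightOneSpectrum.exists_isArithFrobAt_of_mem_primesAbove_holds`, so no junk value and no
  independence-of-choices statement (`eulerFactorAt_spec`) enters.

Supporting lemmas (all proved): elements in the image of a finite-image homomorphism have
finite order (`isOfFinOrder_apply_of_finite_range`, pigeonhole); eigenvalues of finite-order
endomorphisms have absolute value `1` (`norm_eq_one_of_hasEigenvalue_of_pow_eq_one`);
`P^rev(z) = z^{deg P} P(1/z) = ∏ (1 - β z)` for monic `P` over `ℂ`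
(`eval_reverse_of_ne_zero`, `eval_reverse_eq_prod_roots`, Mathlib `eval₂_reverse_mul_pow`,
`Polynomial.Splits.eval_eq_prod_roots_of_monic`); the characteristic polynomial of the
restriction to an invariant submodule equal to `⊤` (`LinearMap.charpoly_restrict_of_eq_top`,
Mathlib `LinearEquiv.charpoly_conj`).

## References

* P. Deligne, J.-P. Serre, *Formes modulaires de poids 1*, Ann. Sci. ÉNS (4) 7 (1974),
  proof of Thm. 4.6, (iii)–(iv), pp. 515–516 (`DeligneSerreASENS1974`).
* J. Neukirch, *Algebraic Number Theory* (1999), Ch. VII §10, (10.1) (`NeukirchANT1999`).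
* J.-P. Serre, *Linear representations of finite groups*, GTM 42, §1.1, §2.1.
-/

noncomputable section

open scoped NumberField
open Field IsDedekindDomain Module NumberField Polynomial

namespace Literature.NumberTheory.GaloisRepresentations

/-! ### Elements in the image of a finite-image homomorphism have finite order -/

/-- If a monoid homomorphism `f` out of a group takes finitely many values, then every `f g`
has finite order (Mathlib `IsOfFinOrder`): two powers `f (g ^ a) = f (g ^ b)`, `a < b`,
coincide (pigeonhole), and `f (g ^ a)` is a unit.  The form `∃ m > 0, (f g) ^ m = 1`
(Mathlib `isOfFinOrder_iff_pow_eq_one`) is `Literature.NumberTheory.Automorphic.exists_pow_eq_one_of_finite_range` of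
`Literature.NumberTheory.Automorphic.LanglandsTunnellLSeriesProofs`, not importable here.
Ref: Serre, *Linear representations of finite groups*, §1.1. [folklore] -/
theorem isOfFinOrder_apply_of_finite_range {G M F : Type*} [Group G] [Monoid M] [FunLike F G M]
    [MonoidHomClass F G M] (f : F) (hfin : (Set.range f).Finite) (g : G) :
    IsOfFinOrder (f g) := by
  obtain ⟨a, b, hab, he⟩ := hfin.exists_lt_map_eq_of_forall_mem (f := fun k : ℕ => f (g ^ k))
    fun k => Set.mem_range_self (g ^ k)
  refine isOfFinOrder_iff_pow_eq_one.mpr ⟨b - a, Nat.sub_pos_of_lt hab, ?_⟩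
  have hu : IsUnit (f (g ^ a)) := (Group.isUnit _).map f
  have h : f (g ^ a) * (f g) ^ (b - a) = f (g ^ a) * 1 := by
    rw [mul_one, ← map_pow, ← map_mul, ← pow_add, Nat.add_sub_cancel' hab.le]
    exact he.symm
  exact hu.mul_left_cancel h

/-! ### Eigenvalues of finite-order endomorphisms are roots of unity -/

/-- The eigenvalues of an endomorphism of finite order `f ^ m = 1` (`m > 0`) of a complex
vector space are roots of unity, hence of absolute value `1`.
Ref: Serre, *Linear representations of finite groups*, §2.1 (proof of Prop. 1). [folklore] -/
theorem norm_eq_one_of_hasEigenvalue_of_pow_eq_one {V : Type*} [AddCommGroup V] [Module ℂ V]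
    {f : Module.End ℂ V} {m : ℕ} (hm : 0 < m) (hf : f ^ m = 1) {μ : ℂ}
    (hμ : f.HasEigenvalue μ) : ‖μ‖ = 1 := by
  obtain ⟨v, hv⟩ := hμ.exists_hasEigenvector
  have h1 : (f ^ m) v = μ ^ m • v := hv.pow_apply m
  rw [hf, Module.End.one_apply] at h1
  have h2 : (μ ^ m - 1) • v = 0 := by rw [sub_smul, one_smul, ← h1, sub_self]
  have h3 : μ ^ m = 1 := by
    rcases smul_eq_zero.mp h2 with h | h
    · exact sub_eq_zero.mp h
    · exact absurd h hv.2
  exact Complex.norm_eq_one_of_pow_eq_one h3 hm.ne'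

/-! ### Reverse polynomials, evaluated -/

/-- `P^rev(z) = z^{deg P} P(1/z)` for `z ≠ 0` (Mathlib `Polynomial.eval₂_reverse_mul_pow`). [folklore] -/
theorem eval_reverse_of_ne_zero (P : ℂ[X]) {z : ℂ} (hz : z ≠ 0) :
    P.reverse.eval z = z ^ P.natDegree * P.eval z⁻¹ := by
  haveI : Invertible z⁻¹ := invertibleOfNonzero (inv_ne_zero hz)
  have h := eval₂_reverse_mul_pow (RingHom.id ℂ) z⁻¹ P
  rw [invOf_eq_inv, inv_inv, eval₂_id, eval₂_id] at h
  calc P.reverse.eval z = P.reverse.eval z * z⁻¹ ^ P.natDegree * z ^ P.natDegree := by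
        rw [mul_assoc, ← mul_pow, inv_mul_cancel₀ hz, one_pow, mul_one]
    _ = z ^ P.natDegree * P.eval z⁻¹ := by rw [h, mul_comm]

/-- For a monic complex polynomial `P = ∏ (X - β)` (roots `β` with multiplicity),
`P^rev(z) = ∏ (1 - β z)` for every `z`.
Ref: Neukirch, *Algebraic Number Theory*, Ch. VII §10 (`det(1 - Frob T) = ∏ (1 - β T)`). [folklore] -/
theorem eval_reverse_eq_prod_roots {P : ℂ[X]} (hP : P.Monic) (z : ℂ) :
    P.reverse.eval z = (P.roots.map fun β => 1 - β * z).prod := by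
  have hs : P.Splits := IsAlgClosed.splits P
  by_cases hz : z = 0
  · subst hz
    simp only [mul_zero, sub_zero, Multiset.map_const', Multiset.prod_replicate, one_pow]
    rw [← coeff_zero_eq_eval_zero, coeff_zero_reverse, hP.leadingCoeff]
  · rw [eval_reverse_of_ne_zero P hz, hs.eval_eq_prod_roots_of_monic hP,
      hs.natDegree_eq_card_roots]
    have hc : z ^ P.roots.card = (P.roots.map fun _ => z).prod := by
      rw [Multiset.map_const', Multiset.prod_replicate]
    rw [hc, ← Multiset.prod_map_mul]
    congr 1
    refine Multiset.map_congr rfl fun β _ => ?_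
    field_simp

/-- `(X² - a X + b)^rev (z) = 1 - a z + b z²`. [folklore] -/
theorem eval_reverse_X_sq_sub_add (a b z : ℂ) :
    (X ^ 2 - C a * X + C b : ℂ[X]).reverse.eval z = 1 - a * z + b * z ^ 2 := by
  have hmon : (X ^ 2 - C a * X + C b : ℂ[X]).Monic := by monicity!
  have hdeg : (X ^ 2 - C a * X + C b : ℂ[X]).natDegree = 2 := by compute_degree!
  by_cases hz : z = 0
  · subst hz
    rw [← coeff_zero_eq_eval_zero, coeff_zero_reverse, hmon.leadingCoeff]
    ring
  · rw [eval_reverse_of_ne_zero _ hz, hdeg]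
    simp only [eval_add, eval_sub, eval_pow, eval_X, eval_mul, eval_C]
    field_simp

/-! ### Characteristic polynomial of a restriction to the top submodule -/

/-- The characteristic polynomial of the restriction of `f` to an invariant submodule equal to
`⊤` is that of `f`. [folklore] -/
theorem LinearMap.charpoly_restrict_of_eq_top {R M : Type*} [CommRing R]
    [AddCommGroup M] [Module R M] [Module.Free R M] [Module.Finite R M] {p : Submodule R M}
    [Module.Free R p] [Module.Finite R p] (f : M →ₗ[R] M) (h : ∀ x ∈ p, f x ∈ p) (hp : p = ⊤) :
    (f.restrict h).charpoly = f.charpoly := by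
  rw [← LinearEquiv.charpoly_conj (LinearEquiv.ofTop p hp) (f.restrict h)]
  congr 1

/-! ### Euler factors of finite-image Artin representations -/

namespace ArtinRep

universe u w

variable {K : Type u} [Field K] {V : Type w} [AddCommGroup V] [Module ℂ V]
  [TopologicalSpace V] [FiniteDimensional ℂ V]

omit [FiniteDimensional ℂ V] in
/-- Powers of the restriction of `ρ σ` to the inertia invariants act as powers of `ρ σ`. [folklore] -/
theorem restrictInertiaInvariants_pow_apply_coe (ρ : ArtinRep K V)
    (𝔓 : Ideal (absIntegers (𝓞 K) K)) (σ : 𝔓.decompositionSubgroup (absoluteGaloisGroup K))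
    (k : ℕ) (v : ρ.fixedSubmodule (𝔓.inertia (absoluteGaloisGroup K))) :
    (((ρ.restrictInertiaInvariants 𝔓 σ) ^ k) v : V) = ((ρ σ) ^ k) (v : V) := by
  induction k generalizing v with
  | zero => simp
  | succ k ih =>
    rw [pow_succ, Module.End.mul_apply, ih, pow_succ, Module.End.mul_apply,
      ContinuousRep.restrictInertiaInvariants_apply]

omit [FiniteDimensional ℂ V] in
/-- If `ρ` has finite image, the restriction of `ρ σ` to `V^{I_𝔓}` has finite order. [folklore] -/
theorem exists_restrictInertiaInvariants_pow_eq_one (ρ : ArtinRep K V)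
    (hfin : (Set.range (ρ : absoluteGaloisGroup K → V →ₗ[ℂ] V)).Finite)
    (𝔓 : Ideal (absIntegers (𝓞 K) K)) (σ : 𝔓.decompositionSubgroup (absoluteGaloisGroup K)) :
    ∃ m : ℕ, 0 < m ∧ (ρ.restrictInertiaInvariants 𝔓 σ) ^ m = 1 := by
  obtain ⟨m, hm, hσm⟩ :=
    (isOfFinOrder_apply_of_finite_range ρ hfin (σ : absoluteGaloisGroup K)).exists_pow_eq_one
  refine ⟨m, hm, LinearMap.ext fun v => Subtype.ext ?_⟩
  rw [restrictInertiaInvariants_pow_apply_coe, hσm]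
  rfl

/-- **Euler factors of a finite-image Artin representation.**  For every finite place `v`,
`L_v(ρ, T) = det(1 - T ρ(Frob_𝔓) | V^{I_𝔓}) = ∏_i (1 - β_i T)` where the `β_i` (the
eigenvalues of Frobenius on the inertia invariants, with multiplicity; at most `dim V` of them)
are roots of unity, in particular `|β_i| = 1` ("`b_p`, `c_p` sont, soit `0`, soit des racines de
l'unité", Deligne–Serre 1974, proof of Thm. 4.6, (iv) — the vanishing ones simply do not occur
in the multiset).  Also covers the junk branch of `eulerFactorAt` (empty multiset).
Ref: Deligne–Serre, *Formes modulaires de poids 1*, Ann. Sci. ÉNS 7 (1974), p. 516 (iv);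
Neukirch, *Algebraic Number Theory*, Ch. VII §10. [cite: DeligneSerreASENS1974, §4 (b) proof of Thm. 4.6 (iv)] -/
theorem exists_card_le_eval_eulerFactorAt_eq_prod (ρ : ArtinRep K V)
    (hfin : (Set.range (ρ : absoluteGaloisGroup K → V →ₗ[ℂ] V)).Finite)
    (v : HeightOneSpectrum (𝓞 K)) :
    ∃ B : Multiset ℂ, Multiset.card B ≤ finrank ℂ V ∧ (∀ β ∈ B, ‖β‖ = 1) ∧
      ∀ z : ℂ, (ρ.eulerFactorAt v).eval z = (B.map fun β => 1 - β * z).prod := by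
  unfold eulerFactorAt
  split_ifs with h
  · set g := ρ.restrictInertiaInvariants h.choose.1
      ⟨h.choose.2, by haveI := h.choose_spec.1.1; exact h.choose_spec.2.mem_stabilizer⟩ with hg
    refine ⟨g.charpoly.roots, ?_, fun β hβ => ?_, fun z => ?_⟩
    · calc Multiset.card g.charpoly.roots ≤ g.charpoly.natDegree := Polynomial.card_roots' _
        _ = finrank ℂ (ρ.fixedSubmodule (h.choose.1.inertia (absoluteGaloisGroup K))) :=
          LinearMap.charpoly_natDegree g
        _ ≤ finrank ℂ V := Submodule.finrank_le _
    · obtain ⟨m, hm, hgm⟩ := ρ.exists_restrictInertiaInvariants_pow_eq_one hfin h.choose.1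
        ⟨h.choose.2, by haveI := h.choose_spec.1.1; exact h.choose_spec.2.mem_stabilizer⟩
      rw [← hg] at hgm
      have hμ : g.HasEigenvalue β :=
        (Module.End.hasEigenvalue_iff_isRoot_charpoly g β).mpr
          ((mem_roots (LinearMap.charpoly_monic g).ne_zero).mp hβ)
      exact norm_eq_one_of_hasEigenvalue_of_pow_eq_one hm hgm hμ
    · rw [eulerPolynomial]
      exact eval_reverse_eq_prod_roots (LinearMap.charpoly_monic g) z
  · exact ⟨0, by simp, by simp, fun z => by simp⟩

/-- `exists_card_le_eval_eulerFactorAt_eq_prod` without the bound on the number of roots: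
`L_v(ρ, T) = ∏_i (1 - β_i T)` with `|β_i| = 1`.
[cite: DeligneSerreASENS1974, §4 (b) proof of Thm. 4.6 (iv)] -/
theorem exists_eval_eulerFactorAt_eq_prod (ρ : ArtinRep K V)
    (hfin : (Set.range (ρ : absoluteGaloisGroup K → V →ₗ[ℂ] V)).Finite)
    (v : HeightOneSpectrum (𝓞 K)) :
    ∃ B : Multiset ℂ, (∀ β ∈ B, ‖β‖ = 1) ∧
      ∀ z : ℂ, (ρ.eulerFactorAt v).eval z = (B.map fun β => 1 - β * z).prod := by
  obtain ⟨B, -, h1, h2⟩ := ρ.exists_card_le_eval_eulerFactorAt_eq_prod hfin v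
  exact ⟨B, h1, h2⟩

/-- **The Euler factor at an unramified place from the characteristic polynomial of Frobenius.**
If `ρ` is unramified at `v` and every arithmetic Frobenius at every `𝔓 ∣ v` has characteristic
polynomial `P` (`GaloisRep.HasFrobCharpolyAt v P ρ`), then `L_v(ρ, T) = P^rev(T)`
(`= det(1 - T Frob_v | V)`): the inertia invariants are all of `V`, and a pair `(𝔓, Frob_𝔓)`
exists (`primesAbove_nonempty`, `exists_isArithFrobAt_of_mem_primesAbove_holds`), so
`eulerFactorAt` does not take its junk value.  No independence-of-choices statement
(`eulerFactorAt_spec`) is needed.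
Ref: Neukirch, *Algebraic Number Theory*, Ch. VII §10, (10.1); Deligne–Serre 1974, (4.1.1) and
proof of Thm. 4.6, (iii). [cite: NeukirchANT1999, VII §10, (10.1)] -/
theorem eulerFactorAt_eq_reverse_of_isUnramifiedAt [NumberField K] (ρ : ArtinRep K V) {v : HeightOneSpectrum (𝓞 K)}
    (hur : GaloisRep.IsUnramifiedAt v ρ) {P : ℂ[X]} (hP : GaloisRep.HasFrobCharpolyAt v P ρ) :
    ρ.eulerFactorAt v = P.reverse := by
  have hex : ∃ 𝔓σ : Ideal (absIntegers (𝓞 K) K) × absoluteGaloisGroup K,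
      𝔓σ.1 ∈ v.primesAbove ∧ IsArithFrobAt (𝓞 K) 𝔓σ.2 𝔓σ.1 := by
    obtain ⟨𝔓, h𝔓⟩ := v.primesAbove_nonempty
    obtain ⟨σ, hσ⟩ := HeightOneSpectrum.exists_isArithFrobAt_of_mem_primesAbove_holds h𝔓
    exact ⟨(𝔓, σ), h𝔓, hσ⟩
  rw [eulerFactorAt, dif_pos hex, eulerPolynomial, ← hP _ hex.choose_spec.1 _ hex.choose_spec.2]
  congr 1
  exact LinearMap.charpoly_restrict_of_eq_top _ _
    (ρ.fixedSubmodule_eq_top_of_forall_eq_one (hur _ hex.choose_spec.1))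

end ArtinRep

end Literature.NumberTheory.GaloisRepresentations
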